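import Summits.BirchSwinnertonDyer.Rank1Residual.GaloisImage.KolyvaginSystemsCoreRankZero
import Summits.BirchSwinnertonDyer.Rank1Residual.X11b.WeilTransport
import HarnessLib

/-!
# `χ(𝓕) = 0 ⟹ KS₁(E[p], 𝓕, 𝒫) = 0`: the reading of the core-rank-zero vanishing theorem for the
# `p`-torsion of an elliptic curve, the residual self-duality being the Weil pairing
# (cell `b2b-bsdres`, team n1011, ROUTE-1 item R1-16, file 4 (E[p]-reading) — lead rulings PLAN.md
# R5-29 (q), R5-31; seat p11; skeleton `cells/n1011/skel/T-R1-16.md`)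

HONEST FRAMING (verbatim for the cell): research route; prove what is provable now; shrink each hard
class to its core with data; no claim beyond stated classes; nothing booked; no mark / label moved.
ONE theorem, no definition, no named fact, no conjecture node: the specialisation of
`CoreRankZero.kolyvaginSystems_eq_bot_of_hasCoreRank_zero_of_selfDual`
(`KolyvaginSystemsCoreRankZero.lean`; Rubin, PCMI 18 (2011) Thm. 2.7.6 at `m = 1` = Mazur–Rubin
Thm. 4.2.2, `χ = 0`) to `T̄ = E[p]` (`W.torsionGaloisModule p`) over a number field `K`, where the
equivariant map `θ' : E[p]^∨(1) → E[p]` is the inverse Weil transport `X11b.LocBridge.weilDualInv`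
(the Weil pairing `e_p` exists: Silverman *AEC* III.8.1 = the tree's `exists_weilPairing_holds`;
`w⁻¹` is injective on `H¹` because `H¹(w) ∘ H¹(w⁻¹) = id`, `map_weilDual_map_weilDualInv`).  The
prime-choice binder `hC55` is Sakamoto, JTNB 36 (2024) Cor. 5.5 (p. 929) VERBATIM (three non-zero
classes of `H¹(K, E[p])`, infinitely many primes of the datum's `𝒫` where all three localise
non-trivially; printed for `p = 3` and the `τ`-class primes `frobeniusClassPrimes`); the local-shape
binders `hU`, `hT`, `hUT` (Rubin Prop. 1.9.5 (1) / Ex. 1.9.7) are the cell's row T-R1-16-LOC, the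
admissibility binder `hadm` its row T-HCC.  Every other binder as in the generic theorem.

References: [Rubin2011] Thm. 2.7.6 (p. 24); [Sakamoto2024] Cor. 5.5 (p. 929); [SilvermanAEC2009]
Prop. III.8.1; [MilneADT2006] I §6, proof of Prop. 6.9 (the Weil transport on `H¹`).
-/

noncomputable section

open scoped Classical NumberField ContRepresentation
open Function NumberField IsDedekindDomain
open Literature.NumberTheory.GaloisRepresentations Literature.NumberTheory.GaloisRepresentations.DiscreteGaloisModule
  Literature.NumberTheory.GaloisCohomology

universe u

namespace Summit.BirchSwinnertonDyer.Rank1Residual.GaloisImage.CoreRankZero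

variable {K : Type u} [Field K] [NumberField K]

open WeierstrassCurve Literature.NumberTheory.EllipticCurves
open Summit.BirchSwinnertonDyer.Rank1Residual.X11b.LocBridge

/-- **`χ(𝓕) = 0 ⟹ KS₁(E[p], 𝓕, 𝒫) = 0` for the `p`-torsion of an elliptic curve over a number
field**, with the prime choice in Sakamoto's printed shape (JTNB 36 (2024) Cor. 5.5, p. 929, printed
for `p = 3`: three non-zero classes of `H¹(K, E[3])`, infinitely many `𝔮 ∈ 𝒫` where all three localise
non-trivially; here a binder for any `p`).
The residual self-duality (H.SD) is the Weil pairing `e_p` (Silverman *AEC* III.8.1, the tree's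
`exists_weilPairing_holds`): the inverse Weil transport `w⁻¹ : E[p]^∨(1) → E[p]`
(`X11b.LocBridge.weilDualInv`) is injective on `H¹` because `H¹(w) ∘ H¹(w⁻¹) = id`
(`map_weilDual_map_weilDualInv`).  All other binders as in
`kolyvaginSystems_eq_bot_of_hasCoreRank_zero` (any Selmer structure `𝓕` on `E[p]` of core rank
`0`, e.g. a residually self-dual one; any Kolyvagin datum with Rubin's local shape at its primes).
[cite: Rubin2011, Thm. 2.7.6 (p. 24)] [cite: Sakamoto2024, Cor. 5.5 (p. 929)]
[cite: SilvermanAEC2009, Prop. III.8.1] -/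
theorem torsion_kolyvaginSystems_eq_bot_of_hasCoreRank_zero (W : WeierstrassCurve K) [W.IsElliptic]
    (p : ℕ) [Fact p.Prime] [Finite (geomTorsion W (p : ℤ))] {inv : LocalInvariants K p}
    (hperf : inv.IsPerfect) (hsum : inv.SumLocalTermEqZero) (hcompl : inv.SelmerComplement)
    {S : Finset (Place K)}
    (hS : ∀ v : HeightOneSpectrum (𝓞 K), (Sum.inr v : Place K) ∉ S →
      ((p : ℕ) : 𝓞 K) ∉ v.asIdeal ∧ GaloisRep.IsUnramifiedAt v (W.torsionGaloisModule (p : ℤ)))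
    {𝓕 : SelmerStructure (W.torsionGaloisModule (p : ℤ))} (h𝓕 : 𝓕.IsUnramifiedOutside S)
    (hfin : Finite 𝓕.selmerGroup)
    (hfind : Finite (inv.dualSelmerStructure (W.torsionGaloisModule (p : ℤ)) 𝓕).selmerGroup)
    (hχ : LocalInvariants.HasCoreRank inv 𝓕 p 0)
    {D : KolyvaginDatum (W.torsionGaloisModule (p : ℤ))}
    (hPS : ∀ q ∈ D.primes, (Sum.inr q : Place K) ∉ S) (hadm : D.IsAdmissible)
    (hU : ∀ q ∈ D.primes,
      Nat.card (unramifiedSubgroup (GaloisRep.toLocal q (W.torsionGaloisModule (p : ℤ))) 1) = p)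
    (hT : ∀ q ∈ D.primes, Nat.card (D.transverse (Sum.inr q)) = p)
    (hUT : ∀ q ∈ D.primes,
      unramifiedSubgroup (GaloisRep.toLocal q (W.torsionGaloisModule (p : ℤ))) 1 ⊔
        D.transverse (Sum.inr q) = ⊤)
    (hC55 : ∀ c₁ c₂ c₃ : galoisCohomology (W.torsionGaloisModule (p : ℤ)) 1, c₁ ≠ 0 → c₂ ≠ 0 →
      c₃ ≠ 0 →
      {q ∈ D.primes |
        galoisCohomology.localization (W.torsionGaloisModule (p : ℤ)) (Sum.inr q) 1 c₁ ≠ 0 ∧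
        galoisCohomology.localization (W.torsionGaloisModule (p : ℤ)) (Sum.inr q) 1 c₂ ≠ 0 ∧
        galoisCohomology.localization (W.torsionGaloisModule (p : ℤ)) (Sum.inr q) 1 c₃ ≠ 0}.Infinite) :
    D.kolyvaginSystems 𝓕 = ⊥ := by
  have hp : p.Prime := Fact.out
  haveI : NeZero p := ⟨hp.ne_zero⟩
  obtain ⟨e, hμ, hadd₁, hadd₂, -, hnondeg, hgal⟩ :=
    exists_weilPairing_holds W p hp.two_le (Nat.cast_ne_zero.2 hp.ne_zero)
  have hM : ∀ m : geomTorsion W (p : ℤ), p • m = 0 := fun T => AddSubgroup.torsionBy.nsmul T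
  refine kolyvaginSystems_eq_bot_of_hasCoreRank_zero_of_selfDual hperf hsum hcompl hM hS h𝓕 hfin
    hfind hχ hPS hadm hU hT hUT (weilDualInv W p e hμ hadd₁ hadd₂ hgal hnondeg) ?_ hC55
  intro y y' h
  have h' := congrArg (galoisCohomology.map (weilDualIntertwining W p e hμ hadd₁ hadd₂ hgal) 1) h
  rwa [map_weilDual_map_weilDualInv, map_weilDual_map_weilDualInv] at h'

end Summit.BirchSwinnertonDyer.Rank1Residual.GaloisImage.CoreRankZero

end
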